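import Literature.NumberTheory.GaloisRepresentations.PrimaryGeneratorHeckeCharacter
import Literature.NumberTheory.GaloisRepresentations.HeckeCharacterArchTypeProofs
import Mathlib.NumberTheory.NumberField.InfinitePlace.TotallyRealComplex
import HarnessLib

/-!
# A Größencharakter of infinity type `σ` (type `(1,0)`) with prescribed unit character — existence

Route `ResidualThetaTransportAtTwo`, crux K0⁺ `HeckeThetaPartnerAdicAtTwo` (stmt-BirchSwinnertonDyer-20690),
helper §E1 of the line "proof from print" (the CM lift at `2` of the cubic character of `ℚ(W[2])/ℚ(√Δ_W)`
needs a Größencharakter of `ℚ(√Δ_W)` of type `(1,0)`, odd conductor and central character `χ_K · N`;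
this file supplies the raw existence statement it is twisted from).  THEOREMS ONLY (no definition, no
named fact, no `sorry`).

**Main result** `exists_isGrossencharakter_embType`: for a number field `k`, an embedding
`σ : k → ℂ`, an ideal `𝔣` of `𝓞 k` and a character `λ` of `(𝓞 k/𝔣)ˣ` with `λ(ū) · σ(u) = 1` for every
unit `u` of `𝓞 k`, there is a Größencharakter `ψ₀ mod 𝔣` of infinity type `σ` in the tree's
ideal-theoretic sense (`Literature.NumberTheory.GaloisRepresentations.IsGrossencharakter 𝔣 (embType σ)
(embTypeConj σ) ψ₀`, `GrossencharakterIdeleValue.lean`, `PrimaryGeneratorHeckeCharacter.lean`) whose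
value on every principal ideal `(b)` prime to `𝔣` is `ψ̃₀((b)) = σ(b) · λ(b̄)`.  Classical (Hecke;
Neukirch, *Algebraic Number Theory* VII §6, Def. (6.1): "`χ((a)) = χ_f(a) χ_∞(a)`"): the character
`b ↦ σ(b) λ(b̄)` of the monoid of non-zero integers prime to `𝔣` depends only on the ideal `(b)` (two
generators differ by a unit `u`, and `σ(u) λ(ū) = 1`), hence factors through the exponent-vector map
into the free abelian group on the primes and extends to all of it because `ℂˣ` is divisible
(`exists_monoidHom_comp_eq`, Baer's criterion through the tree's `Subgroup.exists_monoidHom_extension`).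

References: [NeukirchANT1999] Ch. VII §6 Def. (6.1), Prop. (6.13), Cor. (6.14); E. Hecke, *Eine neue
Art von Zetafunktionen* (1918/1920).
-/

set_option autoImplicit false
set_option linter.dupNamespace false

noncomputable section

open scoped NumberField ComplexConjugate
open NumberField IsDedekindDomain
open Literature.NumberTheory.GaloisRepresentations Literature.NumberTheory.LFunctions

namespace Summit.BirchSwinnertonDyer.BirchSwinnertonDyer.Theorems.HeckeThetaPartner

/-! ### Extension along a monoid map into a divisible group -/

section DivisibleExt

variable {S G C : Type*} [CommMonoid S] [CommGroup G] [CommGroup C]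

/-- **Extension along a monoid map into a divisible group.** If `d : S → G` and `φ : S → C` are
monoid homomorphisms from a commutative monoid, `C` is divisible, and `φ` is constant on the fibres
of `d`, then `φ = Φ ∘ d` for a character `Φ` of `G`: `φ` descends to the subgroup
`{d(s) d(t)⁻¹}` generated by the image of `d` and extends by Baer's criterion
(`Subgroup.exists_monoidHom_extension`). [folklore] -/
theorem exists_monoidHom_comp_eq (hC : ∀ n : ℕ, 0 < n → ∀ c : C, ∃ e : C, e ^ n = c)
    (d : S →* G) (φ : S →* C) (h : ∀ s t : S, d s = d t → φ s = φ t) :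
    ∃ Φ : G →* C, ∀ s : S, Φ (d s) = φ s := by
  classical
  -- the subgroup `H = {d s / d t}`
  let H : Subgroup G :=
    { carrier := {g | ∃ s t : S, g = d s / d t}
      mul_mem' := by
        rintro _ _ ⟨s, t, rfl⟩ ⟨s', t', rfl⟩
        exact ⟨s * s', t * t', by
          rw [map_mul, map_mul]; simp only [div_eq_mul_inv, mul_inv]
          simp only [mul_assoc, mul_left_comm]⟩
      one_mem' := ⟨1, 1, by simp⟩
      inv_mem' := by
        rintro _ ⟨s, t, rfl⟩
        exact ⟨t, s, by simp⟩ }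
  -- `φ` descends to `H`
  have hdesc : ∀ s t s' t' : S, d s / d t = d s' / d t' → φ s / φ t = φ s' / φ t' := by
    intro s t s' t' hst
    have h1 : d (s * t') = d (s' * t) := by
      rw [map_mul, map_mul]
      rw [div_eq_div_iff_mul_eq_mul] at hst
      rw [hst]
    have h2 := h _ _ h1
    rw [map_mul, map_mul] at h2
    rw [div_eq_div_iff_mul_eq_mul, h2]
  have hmem : ∀ g : H, ∃ st : S × S, (g : G) = d st.1 / d st.2 := fun g => by
    obtain ⟨s, t, hg⟩ := g.2
    exact ⟨(s, t), hg⟩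
  choose st hst using hmem
  let φ₀ : H →* C :=
    { toFun := fun g => φ (st g).1 / φ (st g).2
      map_one' := by
        have h1 : d (st 1).1 / d (st 1).2 = d 1 / d 1 := by rw [← hst 1]; simp
        rw [hdesc _ _ _ _ h1, map_one, div_one]
      map_mul' := by
        intro a b
        have hab : d (st (a * b)).1 / d (st (a * b)).2 =
            d ((st a).1 * (st b).1) / d ((st a).2 * (st b).2) := by
          rw [← hst (a * b), Subgroup.coe_mul, hst a, hst b, map_mul, map_mul]
          simp only [div_eq_mul_inv, mul_inv]; simp only [mul_assoc, mul_left_comm]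
        rw [hdesc _ _ _ _ hab, map_mul, map_mul]
        simp only [div_eq_mul_inv, mul_inv]; simp only [mul_assoc, mul_left_comm] }
  obtain ⟨Φ, hΦ⟩ := Subgroup.exists_monoidHom_extension hC H φ₀
  refine ⟨Φ, fun s => ?_⟩
  have hsH : d s ∈ H := ⟨s, 1, by simp⟩
  have h1 := hΦ ⟨d s, hsH⟩
  simp only at h1
  rw [h1]
  change φ (st ⟨d s, hsH⟩).1 / φ (st ⟨d s, hsH⟩).2 = φ s
  have h2 : d (st ⟨d s, hsH⟩).1 / d (st ⟨d s, hsH⟩).2 = d s / d 1 := by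
    rw [← hst ⟨d s, hsH⟩, map_one, div_one]
  rw [hdesc _ _ _ _ h2, map_one, div_one]

/-- `ℂˣ` is divisible (`ℂ` is algebraically closed). [folklore] -/
theorem complexUnits_exists_pow_eq : ∀ n : ℕ, 0 < n → ∀ c : ℂˣ, ∃ e : ℂˣ, e ^ n = c := by
  intro n hn c
  obtain ⟨z, hz⟩ := IsAlgClosed.exists_pow_nat_eq (c : ℂ) hn
  have hz0 : z ≠ 0 := by
    rintro rfl
    rw [zero_pow hn.ne'] at hz
    exact c.ne_zero hz.symm
  exact ⟨Units.mk0 z hz0, Units.ext (by simpa using hz)⟩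

end DivisibleExt

/-! ### The Größencharakter -/

section Main

variable {k : Type} [Field k] [NumberField k]

omit [NumberField k] in
/-- `(b) + 𝔣 = 1` ⇒ `b̄ ∈ (𝓞 k/𝔣)ˣ`. [folklore] -/
theorem isUnit_mk_of_isCoprime {𝔣 : Ideal (𝓞 k)} {b : 𝓞 k} (h : IsCoprime (Ideal.span {b}) 𝔣) :
    IsUnit (Ideal.Quotient.mk 𝔣 b) := by
  rw [Ideal.isCoprime_iff_exists] at h
  obtain ⟨x, hx, y, hy, hxy⟩ := h
  obtain ⟨a, rfl⟩ := Ideal.mem_span_singleton'.mp hx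
  refine isUnit_iff_exists_inv.mpr ⟨Ideal.Quotient.mk 𝔣 a, ?_⟩
  rw [← map_mul, mul_comm, ← (Ideal.Quotient.mk 𝔣).map_one, Ideal.Quotient.eq]
  rw [← hxy]
  simpa using 𝔣.neg_mem hy

omit [NumberField k] in
/-- `b̄ ∈ (𝓞 k/𝔣)ˣ` ⇒ `(b) + 𝔣 = 1`. [folklore] -/
theorem isCoprime_of_isUnit_mk {𝔣 : Ideal (𝓞 k)} {b : 𝓞 k} (h : IsUnit (Ideal.Quotient.mk 𝔣 b)) :
    IsCoprime (Ideal.span {b}) 𝔣 := by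
  obtain ⟨c, hc⟩ := h.exists_left_inv
  obtain ⟨c, rfl⟩ := Ideal.Quotient.mk_surjective c
  rw [← map_mul, ← (Ideal.Quotient.mk 𝔣).map_one, Ideal.Quotient.eq] at hc
  rw [Ideal.isCoprime_iff_exists]
  refine ⟨c * b, Ideal.mem_span_singleton'.mpr ⟨c, rfl⟩, 1 - c * b, ?_, by ring⟩
  simpa using 𝔣.neg_mem hc

/-- **Existence of a Größencharakter of type `(1, 0)` with prescribed unit character.**  Let `k` be
a totally complex number field, `σ : k → ℂ`, `𝔣 ≠ 0` an ideal of `𝓞 k` and `λ` a character of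
`(𝓞 k/𝔣)ˣ` such that `λ(ū) · σ(u) = 1` for every unit `u` of `𝓞 k`.  Then there is a Größencharakter
`ψ₀ mod 𝔣` of infinity type `σ` (ideal-theoretic: `IsGrossencharakter 𝔣 (embType σ) (embTypeConj σ)`)
such that `ψ̃₀((b)) = σ(b) · λ(b̄)` for every non-zero `b ∈ 𝓞 k` prime to `𝔣`.  Proof: on the monoid
of such `b` the character `b ↦ σ(b) λ(b̄)` only depends on the ideal `(b)` (two generators differ by a
unit `u`, and `σ(u) λ(ū) = 1`); it therefore factors through the exponent-vector map into the free
abelian group on the primes and extends to it, `ℂˣ` being divisible (Hecke; Neukirch, *Algebraic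
Number Theory* VII §6, the Größencharaktere `mod 𝔪` of type `(p, q)`). [cite: NeukirchANT1999, Ch. VII §6 Def. (6.1) and Cor. (6.14)] -/
theorem exists_isGrossencharakter_embType (σ : k →+* ℂ) {𝔣 : Ideal (𝓞 k)}
    (lam : (𝓞 k ⧸ 𝔣)ˣ →* ℂˣ)
    (hlam : ∀ u : (𝓞 k)ˣ,
      (lam (Units.map (Ideal.Quotient.mk 𝔣).toMonoidHom u) : ℂ) * σ ((u : 𝓞 k) : k) = 1) :
    ∃ ψ₀ : HeightOneSpectrum (𝓞 k) → ℂ,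
      IsGrossencharakter 𝔣 (embType σ) (embTypeConj σ) ψ₀ ∧
      ∀ (b : 𝓞 k), b ≠ 0 → ∀ hb : IsUnit (Ideal.Quotient.mk 𝔣 b),
        idealPow k ψ₀ (Ideal.span {b}) = σ (b : k) * (lam hb.unit : ℂ) := by
  classical
  -- the free abelian group on the primes and the exponent-vector map
  set G := Multiplicative (HeightOneSpectrum (𝓞 k) →₀ ℤ) with hG
  let e : HeightOneSpectrum (𝓞 k) → G := fun v => Multiplicative.ofAdd (Finsupp.single v 1)
  -- exponent vectors `ν(I) = (ν_𝔭(I))_𝔭` of non-zero ideals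
  let divN : Ideal (𝓞 k) → (HeightOneSpectrum (𝓞 k) →₀ ℕ) := fun I =>
    if hI : I = ⊥ then 0 else
      Finsupp.ofSupportFinite
        (fun v => (Associates.mk v.asIdeal).count (Associates.mk I).factors)
        (by
          have h := Associates.finite_factors hI
          rw [Filter.eventually_cofinite] at h
          refine h.subset fun v hv => ?_
          simpa [Function.mem_support] using hv)
  have divN_apply : ∀ {I : Ideal (𝓞 k)}, I ≠ ⊥ → ∀ v : HeightOneSpectrum (𝓞 k),
      divN I v = (Associates.mk v.asIdeal).count (Associates.mk I).factors := by
    intro I hI v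
    simp only [divN, dif_neg hI]
    rfl
  have prod_divN_pow : ∀ {I : Ideal (𝓞 k)}, I ≠ ⊥ → ((divN I).prod fun v n => v.asIdeal ^ n) = I := by
    intro I hI
    conv_rhs => rw [← Ideal.finprod_heightOneSpectrum_factorization hI]
    rw [Finsupp.prod, ← finprod_eq_prod_of_mulSupport_subset]
    · refine finprod_congr fun v => ?_
      rw [HeightOneSpectrum.maxPowDividing, divN_apply hI]
    · intro v hv
      rw [Function.mem_mulSupport] at hv
      rw [Finset.mem_coe, Finsupp.mem_support_iff]
      intro h0
      exact hv (by rw [h0, pow_zero])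
  have divN_mul : ∀ {I J : Ideal (𝓞 k)}, I ≠ ⊥ → J ≠ ⊥ → divN (I * J) = divN I + divN J := by
    intro I J hI hJ
    ext v
    rw [Finsupp.add_apply, divN_apply hI, divN_apply hJ, divN_apply (mul_ne_zero hI hJ),
      ← Associates.mk_mul_mk,
      Associates.count_mul (Associates.mk_ne_zero.mpr hI) (Associates.mk_ne_zero.mpr hJ)
        ((Associates.irreducible_mk).mpr v.irreducible)]
  have eq_of_divN_eq : ∀ {I J : Ideal (𝓞 k)}, I ≠ ⊥ → J ≠ ⊥ → divN I = divN J → I = J := by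
    intro I J hI hJ h
    rw [← prod_divN_pow hI, ← prod_divN_pow hJ, h]
  have idealPow_eq_prod_divN : ∀ (ψ : HeightOneSpectrum (𝓞 k) → ℂ) {I : Ideal (𝓞 k)}, I ≠ ⊥ →
      idealPow k ψ I = (divN I).prod fun v n => ψ v ^ n := by
    intro ψ I hI
    conv_lhs => rw [← prod_divN_pow hI]
    exact idealPow_finsuppProd ψ (divN I)
  -- the monoid of non-zero integers prime to `𝔣`
  let S : Submonoid (𝓞 k) :=
    { carrier := {b | b ≠ 0 ∧ IsUnit (Ideal.Quotient.mk 𝔣 b)}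
      mul_mem' := by
        rintro a b ⟨ha, hua⟩ ⟨hb, hub⟩
        exact ⟨mul_ne_zero ha hb, by rw [map_mul]; exact hua.mul hub⟩
      one_mem' := ⟨one_ne_zero, by rw [map_one]; exact isUnit_one⟩ }
  have hS0 : ∀ s : S, (s : 𝓞 k) ≠ 0 := fun s => s.2.1
  have hSu : ∀ s : S, IsUnit (Ideal.Quotient.mk 𝔣 (s : 𝓞 k)) := fun s => s.2.2
  have hspan0 : ∀ s : S, Ideal.span {(s : 𝓞 k)} ≠ ⊥ := fun s => by
    rw [Ne, Ideal.span_singleton_eq_bot]; exact hS0 s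
  let d : S →* G :=
    { toFun := fun s => (divN (Ideal.span {(s : 𝓞 k)})).prod fun v n => e v ^ n
      map_one' := by
        have : divN (Ideal.span {((1 : S) : 𝓞 k)}) = 0 := by
          rw [OneMemClass.coe_one, Ideal.span_singleton_one]
          have h := divN_mul (I := ⊤) (J := ⊤) top_ne_bot top_ne_bot
          rw [Ideal.top_mul] at h
          exact left_eq_add.mp h
        rw [this, Finsupp.prod_zero_index]
      map_mul' := fun a b => by
        rw [Submonoid.coe_mul, ← Ideal.span_singleton_mul_span_singleton,
          divN_mul (hspan0 a) (hspan0 b), Finsupp.prod_add_index']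
        · intro v; exact pow_zero _
        · intro v m n; exact pow_add _ _ _ }
  have he : ∀ (w : HeightOneSpectrum (𝓞 k)) (n : ℕ),
      Multiplicative.toAdd (e w ^ n) = Finsupp.single w (n : ℤ) := by
    intro w n
    change Multiplicative.toAdd ((Multiplicative.ofAdd (Finsupp.single w (1 : ℤ))) ^ n) = _
    rw [← ofAdd_nsmul, toAdd_ofAdd, Finsupp.smul_single, nsmul_eq_mul, mul_one]
  have hd_eq : ∀ s : S, Multiplicative.toAdd (d s) =
      Finsupp.mapRange (fun n : ℕ => (n : ℤ)) (by simp) (divN (Ideal.span {(s : 𝓞 k)})) := by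
    intro s
    change Multiplicative.toAdd ((divN (Ideal.span {(s : 𝓞 k)})).prod fun v n => e v ^ n) = _
    ext v
    rw [Finsupp.mapRange_apply, Finsupp.prod, toAdd_prod, Finsupp.finsetSum_apply]
    simp_rw [he, Finsupp.single_apply]
    rw [Finset.sum_ite_eq']
    split_ifs with hv
    · rfl
    · rw [Finsupp.notMem_support_iff] at hv
      simp [hv]
  have hd_inj : ∀ s t : S, d s = d t → Ideal.span {(s : 𝓞 k)} = Ideal.span {(t : 𝓞 k)} := by
    intro s t hst
    have h1 := congrArg Multiplicative.toAdd hst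
    rw [hd_eq, hd_eq] at h1
    exact eq_of_divN_eq (hspan0 s) (hspan0 t)
      (Finsupp.mapRange_injective _ (by simp) (fun a b hab => by exact_mod_cast hab) h1)
  -- the character `b ↦ σ(b) λ(b̄)` on `S`
  have hσ0 : ∀ s : S, σ ((s : 𝓞 k) : k) ≠ 0 := fun s => by
    rw [map_ne_zero]; exact_mod_cast hS0 s
  let φ : S →* ℂˣ :=
    { toFun := fun s => Units.mk0 _ (hσ0 s) * lam (hSu s).unit
      map_one' := by
        have h1 : (hSu 1).unit = 1 := Units.ext (by simp)
        rw [h1, map_one, mul_one]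
        exact Units.ext (by simp)
      map_mul' := fun a b => by
        have hab : (hSu (a * b)).unit = (hSu a).unit * (hSu b).unit :=
          Units.ext (by simp)
        rw [hab, map_mul]
        have : Units.mk0 _ (hσ0 (a * b)) = Units.mk0 _ (hσ0 a) * Units.mk0 _ (hσ0 b) :=
          Units.ext (by simp)
        rw [this]; simp only [mul_assoc, mul_left_comm] }
  -- `φ` only depends on the ideal
  have hφ : ∀ s t : S, d s = d t → φ s = φ t := by
    intro s t hst
    have hI := hd_inj s t hst
    obtain ⟨u, hu⟩ := Ideal.span_singleton_eq_span_singleton.mp hI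
    -- `t = s * u`
    apply Units.ext
    change σ ((s : 𝓞 k) : k) * (lam (hSu s).unit : ℂ) = σ ((t : 𝓞 k) : k) * (lam (hSu t).unit : ℂ)
    have ht : ((t : 𝓞 k) : k) = (s : 𝓞 k) * ((u : 𝓞 k) : k) := by
      rw [← hu]; push_cast; ring
    have hut : (hSu t).unit = (hSu s).unit * Units.map (Ideal.Quotient.mk 𝔣).toMonoidHom u := by
      apply Units.ext
      simp only [IsUnit.unit_spec, Units.val_mul, Units.coe_map, RingHom.toMonoidHom_eq_coe,
        MonoidHom.coe_coe, ← map_mul, hu]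
    rw [hut, map_mul, Units.val_mul, ht, map_mul]
    have := hlam u
    calc σ ((s : 𝓞 k) : k) * (lam (hSu s).unit : ℂ)
        = σ ((s : 𝓞 k) : k) * (lam (hSu s).unit : ℂ) *
            ((lam (Units.map (Ideal.Quotient.mk 𝔣).toMonoidHom u) : ℂ) * σ ((u : 𝓞 k) : k)) := by
          rw [this, mul_one]
      _ = _ := by ring
  -- extend
  obtain ⟨Φ, hΦ⟩ := exists_monoidHom_comp_eq complexUnits_exists_pow_eq d φ hφ
  set ψ₀ : HeightOneSpectrum (𝓞 k) → ℂ := fun v => (Φ (e v) : ℂ) with hψ₀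
  -- the key formula on `S`
  have key : ∀ s : S, idealPow k ψ₀ (Ideal.span {(s : 𝓞 k)}) = (φ s : ℂ) := by
    intro s
    rw [← hΦ s, idealPow_eq_prod_divN ψ₀ (hspan0 s)]
    change ((divN (Ideal.span {(s : 𝓞 k)})).prod fun v n => (Φ (e v) : ℂ) ^ n) =
      (Φ ((divN (Ideal.span {(s : 𝓞 k)})).prod fun v n => e v ^ n) : ℂ)
    rw [map_finsuppProd, Finsupp.prod, Finsupp.prod, Units.coe_prod]
    refine Finset.prod_congr rfl fun v _ => ?_
    rw [map_pow, Units.val_pow_eq_pow_val]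
  have key' : ∀ (b : 𝓞 k) (hb0 : b ≠ 0) (hb : IsUnit (Ideal.Quotient.mk 𝔣 b)),
      idealPow k ψ₀ (Ideal.span {b}) = σ (b : k) * (lam hb.unit : ℂ) := by
    intro b hb0 hb
    have h := key ⟨b, hb0, hb⟩
    rw [h]
    rfl
  refine ⟨ψ₀, ?_, key'⟩
  refine ⟨fun v _ => (Φ (e v)).ne_zero, ?_⟩
  intro b c hb0 hc0 hc hbc _
  have hcu : IsUnit (Ideal.Quotient.mk 𝔣 c) := isUnit_mk_of_isCoprime hc
  have hmk : Ideal.Quotient.mk 𝔣 b = Ideal.Quotient.mk 𝔣 c := Ideal.Quotient.eq.mpr hbc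
  have hbu : IsUnit (Ideal.Quotient.mk 𝔣 b) := hmk ▸ hcu
  have hunits : hbu.unit = hcu.unit := Units.ext (by simp [hmk])
  rw [prod_embedding_zpow_embType, key' b hb0 hbu, key' c hc0 hcu, hunits, map_div₀]
  have hσc : σ (c : k) ≠ 0 := by rw [map_ne_zero]; exact_mod_cast hc0
  field_simp

end Main

end Summit.BirchSwinnertonDyer.BirchSwinnertonDyer.Theorems.HeckeThetaPartner

end
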